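import Mathlib
import HarnessLib
import Literature.Probability.LatticeModels.IsingThermodynamics

/-!
# Stub `stub_dcfStructure` (line `self-energy-pick-inversion`, crux `PrecisionLaplacian.DirectCorrelationStableTail`,
# stmt-CriticalPhenomena-4799) — auxiliary file 2: summability from half-space bounds, and matrix lemmas

Registered helper sub-goal `stub_dcfStructure_auxSummable`: a function `a : ℤ³ → ℝ` that is nonnegative off
the origin and whose finite partial sums over each of the six half-spaces `{x_i ≥ 2}`, `{x_i ≤ -2}` are
bounded by one constant `C` is summable (`summable_of_halfspace_sum_le`): `|a|` is dominated by the sum of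
the indicator of the `27`-point cube `{‖x‖_∞ ≤ 1}` times `|a|` (finite support) and the six half-space
restrictions of `a`, each summable by `summable_of_sum_le` (nonnegative with bounded partial sums).

Also recorded here, for the summability half of the stub (all for an arbitrary kernel / matrix):
* `quad_expand`: the block expansion of the quadratic form of a kernel matrix on `{0} ∪ S`;
* `quad_form_col_inv`, `inv_diag_le_of_coercive`: `(N⁻¹)_{uu} ≤ 1/κ` as soon as the quadratic form of the
  invertible matrix `N` dominates `κ v_u²` (test the `u`-th column of `N⁻¹`);
* `quad_nonneg_of_sq_le`: completing the square;
* `sum_neg_halfspace_le`: transfer of half-space bounds through a coordinate mirror.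

Pure theorem file (no definitions).  References: C. Dellacherie, S. Martínez, J. San Martín, *Inverse
M-matrices and ultrametric matrices*, LNM 2118 (2014), ch. 2 [DellacherieMartinezSanmartin2014] (potentials,
row sums of inverse M-matrices); folklore (direct comparison test).
-/

noncomputable section

namespace Summit.CriticalPhenomena.Ising3DConformalLimit.Cruxes.DirectCorrelationStableTail.SelfEnergyPickInversion

open scoped BigOperators
open Literature.Probability.LatticeModels

/-- Expansion of the quadratic form of the kernel matrix of an even kernel on `{0} ∪ S` (`0 ∉ S`):
`Σ_{p,q} v_p v_q G(q - p) = v_0² G 0 + 2 v_0 Σ_s v_s G s + Σ_{s,s'} v_s v_{s'} G(s' - s)`. -/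
theorem quad_expand (G : Site 3 → ℝ) (heven : ∀ x, G (-x) = G x) (S : Finset (Site 3))
    (hS0 : (0 : Site 3) ∉ S) (v : ↥(insert (0 : Site 3) S) → ℝ) (w : Site 3 → ℝ) (hw : ∀ p, v p = w p.1) :
    ∑ p, ∑ q, v p * v q * G (q.1 - p.1) =
      w 0 ^ 2 * G 0 + 2 * w 0 * ∑ s ∈ S, w s * G s + ∑ s ∈ S, ∑ s' ∈ S, w s * w s' * G (s' - s) := by
  classical
  have h1 : ∑ p, ∑ q, v p * v q * G (q.1 - p.1) =
      ∑ x ∈ insert (0 : Site 3) S, ∑ y ∈ insert (0 : Site 3) S, w x * w y * G (y - x) := by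
    rw [← Finset.sum_coe_sort (insert (0 : Site 3) S)]
    refine Finset.sum_congr rfl fun p _ => ?_
    rw [← Finset.sum_coe_sort (insert (0 : Site 3) S)]
    simp only [hw]
  rw [h1, Finset.sum_insert hS0, Finset.sum_insert hS0]
  simp only [Finset.sum_insert hS0, sub_zero, zero_sub, heven, sub_self, Finset.sum_add_distrib]
  have h2 : ∑ x ∈ S, w x * w 0 * G x = w 0 * ∑ s ∈ S, w s * G s := by
    rw [Finset.mul_sum]
    exact Finset.sum_congr rfl fun x _ => by ring
  have h3 : ∑ x ∈ S, w 0 * w x * G x = w 0 * ∑ s ∈ S, w s * G s := by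
    rw [Finset.mul_sum]
    exact Finset.sum_congr rfl fun x _ => by ring
  rw [h2, h3]
  ring

/-- For an invertible matrix `N` and the `u`-th column `v = N⁻¹ e_u` of its inverse,
`Σ_{p,q} v_p v_q N_{pq} = (N⁻¹)_{uu}`. -/
theorem quad_form_col_inv {n : Type*} [Fintype n] [DecidableEq n] (N : Matrix n n ℝ)
    (hN : IsUnit N.det) (u : n) :
    ∑ p, ∑ q, N⁻¹ p u * N⁻¹ q u * N p q = N⁻¹ u u := by
  have hmul : N * N⁻¹ = 1 := Matrix.mul_nonsing_inv N hN
  calc ∑ p, ∑ q, N⁻¹ p u * N⁻¹ q u * N p q = ∑ p, N⁻¹ p u * (N * N⁻¹) p u := by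
        refine Finset.sum_congr rfl fun p _ => ?_
        rw [Matrix.mul_apply, Finset.mul_sum]
        exact Finset.sum_congr rfl fun q _ => by ring
    _ = N⁻¹ u u := by
        rw [hmul]
        simp [Matrix.one_apply]

/-- **Diagonal entries of the inverse from coercivity.**  If `N` is invertible and its quadratic form
dominates `κ v_u²`, `κ > 0`, then `(N⁻¹)_{uu} ≤ 1/κ` (test the column `N⁻¹ e_u`). -/
theorem inv_diag_le_of_coercive {n : Type*} [Fintype n] [DecidableEq n] (N : Matrix n n ℝ)
    (hN : IsUnit N.det) (u : n) (κ : ℝ) (hκ : 0 < κ)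
    (hcoer : ∀ v : n → ℝ, κ * v u ^ 2 ≤ ∑ p, ∑ q, v p * v q * N p q) : N⁻¹ u u ≤ 1 / κ := by
  have h := hcoer fun q => N⁻¹ q u
  rw [quad_form_col_inv N hN u] at h
  rw [le_div_iff₀ hκ]
  by_cases ht : N⁻¹ u u ≤ 0
  · nlinarith
  · push Not at ht
    nlinarith

/-- Completing the square: `C² ≤ a B`, `a, B ≥ 0` imply `a t² + 2 t C + B ≥ 0` for all `t`. -/
theorem quad_nonneg_of_sq_le (a B C t : ℝ) (ha : 0 ≤ a) (hB : 0 ≤ B) (h : C ^ 2 ≤ a * B) :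
    0 ≤ a * t ^ 2 + 2 * t * C + B := by
  by_cases ha0 : a = 0
  · subst ha0
    have hC : C = 0 := by nlinarith
    subst hC
    nlinarith
  · have ha' : 0 < a := lt_of_le_of_ne ha (Ne.symm ha0)
    have key : 0 ≤ a * (a * t ^ 2 + 2 * t * C + B) := by nlinarith [sq_nonneg (a * t + C)]
    by_contra hX
    push Not at hX
    linarith [mul_neg_of_pos_of_neg ha' hX]

/-- **Summability from one-sided half-space bounds.**  A function on `ℤ³`, nonnegative off `0`, whose finite
partial sums over each of the six half-spaces `{±x_i ≥ 2}` are bounded by `C`, is summable (the remaining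
`27` points form a finite set). -/
theorem summable_of_halfspace_sum_le (a : Site 3 → ℝ) (hnn : ∀ x : Site 3, x ≠ 0 → 0 ≤ a x) (C : ℝ)
    (hpos : ∀ (i : Fin 3) (S : Finset (Site 3)), (∀ s ∈ S, 2 ≤ s i) → ∑ y ∈ S, a y ≤ C)
    (hneg : ∀ (i : Fin 3) (S : Finset (Site 3)), (∀ s ∈ S, s i ≤ -2) → ∑ y ∈ S, a y ≤ C) :
    Summable a := by
  classical
  have hP : ∀ i : Fin 3, Summable ({y : Site 3 | 2 ≤ y i}.indicator a) := by
    intro i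
    refine summable_of_sum_le (c := C) (fun y => Set.indicator_apply_nonneg fun hy => hnn y ?_) fun u => ?_
    · rintro rfl
      simp at hy
    · rw [Finset.sum_indicator_eq_sum_filter]
      exact hpos i _ fun s hs => (Finset.mem_filter.mp hs).2
  have hN : ∀ i : Fin 3, Summable ({y : Site 3 | y i ≤ -2}.indicator a) := by
    intro i
    refine summable_of_sum_le (c := C) (fun y => Set.indicator_apply_nonneg fun hy => hnn y ?_) fun u => ?_
    · rintro rfl
      simp at hy
    · rw [Finset.sum_indicator_eq_sum_filter]
      exact hneg i _ fun s hs => (Finset.mem_filter.mp hs).2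
  let K : Finset (Site 3) := Fintype.piFinset fun _ => Finset.Icc (-1 : ℤ) 1
  have hK : Summable ((↑K : Set (Site 3)).indicator fun y => |a y|) := by
    refine summable_of_ne_finset_zero (s := K) fun b hb => ?_
    exact Set.indicator_of_notMem (by simpa using hb) _
  refine Summable.of_norm_bounded (g := fun y => ((↑K : Set (Site 3)).indicator (fun y => |a y|) y +
      ∑ i : Fin 3, {y : Site 3 | 2 ≤ y i}.indicator a y) + ∑ i : Fin 3, {y : Site 3 | y i ≤ -2}.indicator a y)
    ((hK.add (summable_sum fun i _ => hP i)).add (summable_sum fun i _ => hN i)) fun y => ?_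
  have hPnn : ∀ i, 0 ≤ {y : Site 3 | 2 ≤ y i}.indicator a y := fun i =>
    Set.indicator_apply_nonneg fun hy => hnn y (by rintro rfl; simp at hy)
  have hNnn : ∀ i, 0 ≤ {y : Site 3 | y i ≤ -2}.indicator a y := fun i =>
    Set.indicator_apply_nonneg fun hy => hnn y (by rintro rfl; simp at hy)
  have hKnn : 0 ≤ (↑K : Set (Site 3)).indicator (fun y => |a y|) y :=
    Set.indicator_apply_nonneg fun _ => abs_nonneg _
  rw [Real.norm_eq_abs]
  by_cases hy : y ∈ K
  · rw [Set.indicator_of_mem (Finset.mem_coe.mpr hy)]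
    have h1 := Finset.sum_nonneg fun i (_ : i ∈ (Finset.univ : Finset (Fin 3))) => hPnn i
    have h2 := Finset.sum_nonneg fun i (_ : i ∈ (Finset.univ : Finset (Fin 3))) => hNnn i
    linarith
  · have hy' : ∃ i : Fin 3, y i < -1 ∨ 1 < y i := by
      by_contra hcon
      push Not at hcon
      exact hy (Fintype.mem_piFinset.mpr fun i => Finset.mem_Icc.mpr (hcon i))
    obtain ⟨i, hi⟩ := hy'
    have hy0 : y ≠ 0 := by
      rintro rfl
      simp at hi
    rw [abs_of_nonneg (hnn y hy0)]
    rcases hi with hi | hi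
    · have hmem : y ∈ {y : Site 3 | y i ≤ -2} := by simp; omega
      have h1 := Finset.sum_nonneg fun i (_ : i ∈ (Finset.univ : Finset (Fin 3))) => hPnn i
      have h2 : {y : Site 3 | y i ≤ -2}.indicator a y ≤ ∑ i : Fin 3, {y : Site 3 | y i ≤ -2}.indicator a y :=
        Finset.single_le_sum (fun i _ => hNnn i) (Finset.mem_univ i)
      rw [Set.indicator_of_mem hmem] at h2
      linarith
    · have hmem : y ∈ {y : Site 3 | 2 ≤ y i} := by simp; omega
      have h1 := Finset.sum_nonneg fun i (_ : i ∈ (Finset.univ : Finset (Fin 3))) => hNnn i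
      have h2 : {y : Site 3 | 2 ≤ y i}.indicator a y ≤ ∑ i : Fin 3, {y : Site 3 | 2 ≤ y i}.indicator a y :=
        Finset.single_le_sum (fun i _ => hPnn i) (Finset.mem_univ i)
      rw [Set.indicator_of_mem hmem] at h2
      linarith

/-- **Mirror transfer of half-space bounds.**  If `a` is invariant under the sign change of the `i`-th
coordinate and its partial sums over finite subsets of `{x_i ≥ 2}` are `≤ C`, so are those over finite
subsets of `{x_i ≤ -2}`. -/
theorem sum_neg_halfspace_le (a : Site 3 → ℝ) (i : Fin 3) (C : ℝ)
    (hrefl : ∀ x : Site 3, a (Function.update x i (-x i)) = a x)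
    (hpos : ∀ S : Finset (Site 3), (∀ s ∈ S, 2 ≤ s i) → ∑ y ∈ S, a y ≤ C)
    (S : Finset (Site 3)) (hS : ∀ s ∈ S, s i ≤ -2) : ∑ y ∈ S, a y ≤ C := by
  classical
  have hinv : ∀ y : Site 3, Function.update (Function.update y i (-y i)) i
      (-(Function.update y i (-y i)) i) = y := by
    intro y
    funext k
    by_cases hk : k = i
    · subst hk; simp
    · simp [Function.update_of_ne hk]
  have hinj : Set.InjOn (fun x : Site 3 => Function.update x i (-x i)) ↑S := by
    intro x _ y _ hxy
    have h := congrArg (fun z : Site 3 => Function.update z i (-z i)) hxy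
    simpa only [hinv] using h
  calc ∑ y ∈ S, a y = ∑ y ∈ S, a (Function.update y i (-y i)) :=
        Finset.sum_congr rfl fun y _ => (hrefl y).symm
    _ = ∑ z ∈ S.image (fun x => Function.update x i (-x i)), a z := (Finset.sum_image hinj).symm
    _ ≤ C := hpos _ fun z hz => by
        obtain ⟨y, hy, rfl⟩ := Finset.mem_image.mp hz
        have := hS y hy
        simp
        linarith

/-- **Registered helper sub-goal `stub_dcfStructure_auxSummable`** of stub `stub_dcfStructure` (item
stmt-CriticalPhenomena-4799): summability on `ℤ³` from nonnegativity off `0` and uniformly bounded finite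
partial sums over the six half-spaces `{±x_i ≥ 2}` (`summable_of_halfspace_sum_le`). -/
theorem stub_dcfStructure_auxSummable :
    ∀ (a : Site 3 → ℝ) (C : ℝ), (∀ x : Site 3, x ≠ 0 → 0 ≤ a x) → (∀ (i : Fin 3) (S : Finset (Site 3)),
      (∀ s ∈ S, 2 ≤ s i) → ∑ y ∈ S, a y ≤ C) → (∀ (i : Fin 3) (S : Finset (Site 3)), (∀ s ∈ S, s i ≤ -2) →
      ∑ y ∈ S, a y ≤ C) → Summable a :=
  fun a C hnn hpos hneg => summable_of_halfspace_sum_le a hnn C hpos hneg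

end Summit.CriticalPhenomena.Ising3DConformalLimit.Cruxes.DirectCorrelationStableTail.SelfEnergyPickInversion

end
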